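import Summits.RiemannHypothesis.RiemannHypothesis.Theses.GroundBarta
import Summits.RiemannHypothesis.RiemannHypothesis.Theorems.GroundBartaPolarPerronFrobeniusEvenNormalForm
import Summits.RiemannHypothesis.RiemannHypothesis.Theorems.GroundBartaGroundBartaFloorBarta
import Summits.RiemannHypothesis.RiemannHypothesis.Theorems.GroundBartaGroundBartaFloorRateDecay
import Summits.RiemannHypothesis.RiemannHypothesis.Theorems.GroundBartaOddNegativityOffLine
import Summits.RiemannHypothesis.RiemannHypothesis.Theorems.WeilGroundStateGroundStatesConvergeToXiEvenWitness
import HarnessLib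

/-!
# RiemannHypothesis / GroundBarta — crux `PolarPerronFrobenius` (stmt-RiemannHypothesis-18390):
# SIGN ⇒ PARITY, and the logical status of the crux after the proved rungs

Helper file (`--supports stmt-RiemannHypothesis-18390`), RH-free, Mathlib + landed tree files only, no
definitions, no named facts.  The crux is `∀ A, ∃ a ≥ A, (EW a → GSP a)` (`polarPerronFrobenius_iff_groundEnergy`:
`EW a ↔ ε_ev(a) ≤ ε_od(a)`, `GSP a ↔` some ground state of the FULL windowed Weil form at `a` is real and
`≥ 0` a.e. on `(-a, a)`).  This file records four facts about that shape.

1. **SIGN ⇒ PARITY** (`weilEvenGroundEnergy_eq_weilGroundEnergy_of_oneSigned`,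
   `weilEvenGroundEnergy_le_weilOddGroundEnergy_of_oneSigned`, `evenWinsAt_of_oneSigned`): a window that
   carries a ONE-SIGNED ground state is EVEN-WINNING — `ε_ev(a) = ε(a) ≤ ε_od(a)`.  (The normalised even part
   of a one-signed ground state is an even ground state, `exists_even_real_nonneg_of_oneSigned`; an even
   ground state pins the even bottom to the bottom, `weilEvenGroundEnergy_eq_of_even_groundState`.)  So the
   hypothesis `EW a` of the crux is NECESSARY for its conclusion: it is not idle, and at a strictly
   odd-winning window (`ε_od(a) < ε_ev(a)`) every real ground state CHANGES SIGN on the open window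
   (`not_oneSigned_of_weilOddGroundEnergy_lt`, `changesSign_of_weilOddGroundEnergy_lt`).
2. **Normal form** (`polarPerronFrobenius_iff_cofinal_iff`): `PolarPerronFrobenius ↔ ∀ A, ∃ a ≥ A,
   (EW a ↔ GSP a)` — beyond every height, parity order and Perron–Frobenius sign AGREE at some window.
3. **Cofinal one-signed ground states prove RH, unconditionally** (`riemannHypothesis_of_cofinal_oneSigned`):
   the rung `GroundBartaFloor` (PROVED, `neg_groundBartaRate_le_weilGroundEnergy` + `stub_groundRateDecay`)
   and the detector `OddNegativityOffLine` (PROVED) give `∀ A, ∃ a ≥ A, GSP a → RiemannHypothesis` with no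
   parity input at all (the refuter's `rh_of_floor_of_cofinal_GSP` of CruxAttack-r1 with the floor discharged).
4. **Status of the crux** (`riemannHypothesis_of_polarPerronFrobenius_of_eventually_le`,
   `polarPerronFrobenius_imp_riemannHypothesis_or_frequently_lt`,
   `polarPerronFrobenius_iff_frequently_lt_of_not_riemannHypothesis`): the route's rung 4
   (`EvenWinsBeyondArch`, all windows `a > (log 2)/2`) may be weakened to its TAIL `∀ᶠ a, ε_ev(a) ≤ ε_od(a)`;
   the crux implies `RH ∨ (∃ᶠ a, ε_od(a) < ε_ev(a))`; and if RH fails the crux is EXACTLY cofinal strict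
   odd-winning (parity alternation beyond every height), its Perron–Frobenius content being then void.

Prover B, speedrun unit `sr-gb-rung-b` (seat 3).  References: E. Bombieri, Rend. Lincei (9) 11 (2000) §4
(sector bottoms, Lemma 1); H. Yoshida, Adv. Stud. Pure Math. 21 (1992) Prop. 1 (odd criterion).
-/

set_option linter.dupNamespace false

noncomputable section

open MeasureTheory Complex Filter Set
open scoped Real Topology

namespace Summit.RiemannHypothesis.RiemannHypothesis.Theorems.PolarPerronFrobenius

open Literature.NumberTheory.LFunctions
open Summit.RiemannHypothesis.RiemannHypothesis.Theses.GroundBarta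

/-! ### 1. SIGN ⇒ PARITY at one window -/

/-- **A one-signed ground state pins the even bottom to the bottom**: if the window `a` carries a ground
state of the full windowed Weil form that is real and `≥ 0` a.e. on `(-a, a)`, then `ε_ev(a) = ε(a)`.
(Its normalised even part is an EVEN ground state — for `u ≥ 0` the even part cannot vanish — and an
even ground state is an `L²`-limit of the even parts of its minimising sequence, which are even window
tests with Rayleigh quotients `→ ε(a)`.) [folklore] -/
theorem weilEvenGroundEnergy_eq_weilGroundEnergy_of_oneSigned {a : ℝ} {u : ℝ → ℂ}
    (hu : IsWeilGroundState a u)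
    (hsign : ∀ᵐ t : ℝ, t ∈ Ioo (-a) a → (u t).im = 0 ∧ 0 ≤ (u t).re) :
    weilEvenGroundEnergy a = weilGroundEnergy a := by
  obtain ⟨v, hv, hev, -, -⟩ := exists_even_real_nonneg_of_oneSigned hu hsign
  exact GroundStatesConvergeToXi.weilEvenGroundEnergy_eq_of_even_groundState hv hev

/-- **SIGN ⇒ PARITY ORDER**: a window carrying a one-signed ground state is even-winning,
`ε_ev(a) ≤ ε_od(a)` (`ε_ev(a) = ε(a) = min(ε_ev(a), ε_od(a))`). [folklore] -/
theorem weilEvenGroundEnergy_le_weilOddGroundEnergy_of_oneSigned {a : ℝ} {u : ℝ → ℂ}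
    (hu : IsWeilGroundState a u)
    (hsign : ∀ᵐ t : ℝ, t ∈ Ioo (-a) a → (u t).im = 0 ∧ 0 ≤ (u t).re) :
    weilEvenGroundEnergy a ≤ weilOddGroundEnergy a := by
  rw [weilEvenGroundEnergy_eq_weilGroundEnergy_of_oneSigned hu hsign]
  exact weilGroundEnergy_le_weilOddGroundEnergy a

/-- **SIGN ⇒ EVEN-WINNING (matching form)**: at a window carrying a one-signed ground state every odd
`L²`-normalised window test is matched up to any `δ > 0` by an even one — the window-`a` clause of
`EvenWinsBeyondArch`, i.e. the HYPOTHESIS of the crux's matrix, follows from its CONCLUSION. [folklore] -/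
theorem evenWinsAt_of_oneSigned {a : ℝ} {u : ℝ → ℂ} (hu : IsWeilGroundState a u)
    (hsign : ∀ᵐ t : ℝ, t ∈ Ioo (-a) a → (u t).im = 0 ∧ 0 ≤ (u t).re) :
    ∀ o : ℝ → ℂ, IsWeilTest o → tsupport o ⊆ Icc (-a) a → (∀ t, o (-t) = -o t) →
      ∫ t, ‖o t‖ ^ 2 = (1 : ℝ) → ∀ δ : ℝ, 0 < δ → ∃ e : ℝ → ℂ, IsWeilTest e ∧
        tsupport e ⊆ Icc (-a) a ∧ (∀ t, e (-t) = e t) ∧ ∫ t, ‖e t‖ ^ 2 = (1 : ℝ) ∧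
        (weilQuadratic e).re ≤ (weilQuadratic o).re + δ :=
  WeilParity.evenWinsAt_of_le hu.pos (weilEvenGroundEnergy_le_weilOddGroundEnergy_of_oneSigned hu hsign)

/-- **At a strictly odd-winning window no ground state is one-signed**: if `ε_od(a) < ε_ev(a)` then no
ground state of the full windowed form at `a` is real and `≥ 0` a.e. on `(-a, a)`. [folklore] -/
theorem not_oneSigned_of_weilOddGroundEnergy_lt {a : ℝ}
    (hlt : weilOddGroundEnergy a < weilEvenGroundEnergy a) {u : ℝ → ℂ} (hu : IsWeilGroundState a u) :
    ¬ (∀ᵐ t : ℝ, t ∈ Ioo (-a) a → (u t).im = 0 ∧ 0 ≤ (u t).re) :=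
  fun hsign ↦ (not_le.2 hlt) (weilEvenGroundEnergy_le_weilOddGroundEnergy_of_oneSigned hu hsign)

/-- **At a strictly odd-winning window every real-valued ground state CHANGES SIGN on the open window**:
neither `Re u ≥ 0` a.e. nor `Re u ≤ 0` a.e. on `(-a, a)` (the latter by the sign flip
`exists_nonneg_of_nonpos`). [folklore] -/
theorem changesSign_of_weilOddGroundEnergy_lt {a : ℝ}
    (hlt : weilOddGroundEnergy a < weilEvenGroundEnergy a) {u : ℝ → ℂ} (hu : IsWeilGroundState a u)
    (hre : ∀ t, (u t).im = 0) :
    ¬ (∀ᵐ t : ℝ, t ∈ Ioo (-a) a → 0 ≤ (u t).re) ∧ ¬ (∀ᵐ t : ℝ, t ∈ Ioo (-a) a → (u t).re ≤ 0) := by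
  refine ⟨fun hpos ↦ ?_, fun hneg ↦ ?_⟩
  · refine not_oneSigned_of_weilOddGroundEnergy_lt hlt hu ?_
    filter_upwards [hpos] with t ht
    exact fun htI ↦ ⟨hre t, ht htI⟩
  · obtain ⟨v, hv, hvs⟩ := exists_nonneg_of_nonpos hu hre hneg
    exact not_oneSigned_of_weilOddGroundEnergy_lt hlt hv hvs

/-! ### 2. Normal form: parity order and Perron–Frobenius sign agree cofinally -/

/-- **`PolarPerronFrobenius ↔` beyond every height there is a window at which EVEN-WINNING and the
existence of a ONE-SIGNED GROUND STATE are EQUIVALENT** (`→` of the inner equivalence is the crux's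
matrix, `←` is SIGN ⇒ PARITY, free at every window). [folklore] -/
theorem polarPerronFrobenius_iff_cofinal_iff :
    PolarPerronFrobenius ↔
      ∀ A : ℝ, ∃ a : ℝ, A ≤ a ∧ (weilEvenGroundEnergy a ≤ weilOddGroundEnergy a ↔
        ∃ u : ℝ → ℂ, IsWeilGroundState a u ∧
          ∀ᵐ t : ℝ, t ∈ Ioo (-a) a → (u t).im = 0 ∧ 0 ≤ (u t).re) := by
  rw [polarPerronFrobenius_iff_groundEnergy]
  refine forall_congr' fun A ↦ exists_congr fun a ↦ and_congr_right fun _ ↦ ⟨fun h ↦ ⟨h, ?_⟩, Iff.mp⟩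
  rintro ⟨u, hu, hsign⟩
  exact weilEvenGroundEnergy_le_weilOddGroundEnergy_of_oneSigned hu hsign

/-! ### 3. Cofinal one-signed ground states prove RH (floor and detector discharged) -/

/-- **Cofinal one-signed ground states imply the Riemann Hypothesis — unconditionally.**  If beyond every
height some window carries a ground state of the full windowed Weil form that is real and `≥ 0` a.e. on
the open window, RH holds: otherwise `OddNegativityOffLine` (PROVED) gives `η > 0` and normalised odd
tests of energy `≤ -η` at every large window, while the ground Barta floor (rung 2, PROVED:
`ε(a) ≥ -e(a)` at every window carrying a one-signed ground state, `e → 0`) gives `ε(a) > -η` at the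
witness windows beyond the height where `e < η`.  No parity hypothesis enters. [folklore] -/
theorem riemannHypothesis_of_cofinal_oneSigned
    (h : ∀ A : ℝ, ∃ a : ℝ, A ≤ a ∧ ∃ u : ℝ → ℂ, IsWeilGroundState a u ∧
      ∀ᵐ t : ℝ, t ∈ Ioo (-a) a → (u t).im = 0 ∧ 0 ≤ (u t).re) :
    RiemannHypothesis := by
  by_contra hRH
  have hneg : ∃ η : ℝ, 0 < η ∧ ∃ A : ℝ, ∀ a : ℝ, A ≤ a → ∃ k : ℝ → ℂ,
      IsWeilTest k ∧ tsupport k ⊆ Icc (-a) a ∧ (∀ t, k (-t) = -k t) ∧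
      ∫ t, ‖k t‖ ^ 2 = (1 : ℝ) ∧ (weilQuadratic k).re ≤ -η :=
    GroundBarta.oddNegativityOffLine_proof hRH
  obtain ⟨η, hη, A, hA⟩ := hneg
  have hdec : Tendsto GroundBartaFloor.groundBartaRate atTop (𝓝 0) :=
    GroundBartaFloor.stub_groundRateDecay
  obtain ⟨A₁, hA₁⟩ := eventually_atTop.1 (hdec.eventually (Iio_mem_nhds hη))
  obtain ⟨a, ha, u, hu, hsign⟩ := h (max A A₁)
  have hfloor := GroundBartaFloor.neg_groundBartaRate_le_weilGroundEnergy hu.pos hu hsign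
  obtain ⟨k, hk, hks, -, hkn, hkQ⟩ := hA a ((le_max_left _ _).trans ha)
  have h1 : weilGroundEnergy a ≤ (weilQuadratic k).re := weilGroundEnergy_le_of_sphere hk hks hkn
  have h2 : GroundBartaFloor.groundBartaRate a < η := hA₁ a ((le_max_right _ _).trans ha)
  linarith

/-- The same in the route's inline (junk-free) vocabulary for the ground state. [folklore] -/
theorem riemannHypothesis_of_cofinal_oneSigned_inline
    (h : ∀ A : ℝ, ∃ a : ℝ, A ≤ a ∧ ∃ u : ℝ → ℂ, (MemLp u 2 ∧ ∃ g : ℕ → ℝ → ℂ,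
        (∀ n, IsWeilTest (g n) ∧ tsupport (g n) ⊆ Icc (-a) a ∧ ∫ t, ‖g n t‖ ^ 2 = (1 : ℝ)) ∧
        (∀ h : ℝ → ℂ, IsWeilTest h → tsupport h ⊆ Icc (-a) a → ∫ t, ‖h t‖ ^ 2 = (1 : ℝ) →
          ∀ δ : ℝ, 0 < δ → ∀ᶠ n in atTop, (weilQuadratic (g n)).re ≤ (weilQuadratic h).re + δ) ∧
        Tendsto (fun n ↦ ∫ t, ‖g n t - u t‖ ^ 2) atTop (𝓝 0)) ∧
      ∀ᵐ t : ℝ, t ∈ Ioo (-a) a → (u t).im = 0 ∧ 0 ≤ (u t).re) :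
    RiemannHypothesis :=
  riemannHypothesis_of_cofinal_oneSigned fun A ↦ (h A).imp fun a ha ↦
    ⟨ha.1, ha.2.imp fun u hu ↦ ⟨(isWeilGroundState_iff_forall_eventually_le a u).2 hu.1, hu.2⟩⟩

/-! ### 4. Status of the crux: the tail of rung 4 suffices; the `¬RH` normal form -/

/-- **Rung 4 may be weakened to its tail.**  `PolarPerronFrobenius` together with EVENTUAL parity order
`∀ᶠ a, ε_ev(a) ≤ ε_od(a)` (instead of `EvenWinsBeyondArch` at every window `a > (log 2)/2`) already proves
RH: the crux then produces one-signed ground states cofinally. [folklore] -/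
theorem riemannHypothesis_of_polarPerronFrobenius_of_eventually_le (hPF : PolarPerronFrobenius)
    (hle : ∀ᶠ a in atTop, weilEvenGroundEnergy a ≤ weilOddGroundEnergy a) : RiemannHypothesis := by
  obtain ⟨A₀, hA₀⟩ := eventually_atTop.1 hle
  refine riemannHypothesis_of_cofinal_oneSigned fun A ↦ ?_
  obtain ⟨a, ha, hmat⟩ := polarPerronFrobenius_iff_groundEnergy.1 hPF (max A A₀)
  exact ⟨a, (le_max_left _ _).trans ha, hmat (hA₀ a ((le_max_right _ _).trans ha))⟩

/-- **The dichotomy the crux implies**: `PolarPerronFrobenius → RH ∨ (∃ᶠ a, ε_od(a) < ε_ev(a))` — either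
the Riemann Hypothesis, or the odd sector wins strictly at arbitrarily large windows. [folklore] -/
theorem polarPerronFrobenius_imp_riemannHypothesis_or_frequently_lt (hPF : PolarPerronFrobenius) :
    RiemannHypothesis ∨ ∃ᶠ a in atTop, weilOddGroundEnergy a < weilEvenGroundEnergy a := by
  by_cases hfr : ∃ᶠ a in atTop, weilOddGroundEnergy a < weilEvenGroundEnergy a
  · exact Or.inr hfr
  · refine Or.inl (riemannHypothesis_of_polarPerronFrobenius_of_eventually_le hPF ?_)
    exact (not_frequently.1 hfr).mono fun a ha ↦ not_lt.1 ha

/-- **If RH fails, the crux is exactly cofinal strict odd-winning** (`¬RH → (PolarPerronFrobenius ↔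
∃ᶠ a, ε_od(a) < ε_ev(a))`): its Perron–Frobenius content is void off the Riemann Hypothesis, where it
asserts parity alternation beyond every height (the refuter's F-table row "¬RH: C ↔ ∃ᶠ ¬EW", now with the
floor discharged). [folklore] -/
theorem polarPerronFrobenius_iff_frequently_lt_of_not_riemannHypothesis (hRH : ¬ RiemannHypothesis) :
    PolarPerronFrobenius ↔ ∃ᶠ a in atTop, weilOddGroundEnergy a < weilEvenGroundEnergy a :=
  ⟨fun hPF ↦ (polarPerronFrobenius_imp_riemannHypothesis_or_frequently_lt hPF).resolve_left hRH,
    polarPerronFrobenius_of_frequently_lt⟩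

/-- **If RH fails, no large window carries a one-signed ground state** (floor + detector; contrapositive of
`riemannHypothesis_of_cofinal_oneSigned`). [folklore] -/
theorem eventually_not_oneSigned_of_not_riemannHypothesis (hRH : ¬ RiemannHypothesis) :
    ∀ᶠ a in atTop, ∀ u : ℝ → ℂ, IsWeilGroundState a u →
      ¬ (∀ᵐ t : ℝ, t ∈ Ioo (-a) a → (u t).im = 0 ∧ 0 ≤ (u t).re) := by
  by_contra hne
  refine hRH (riemannHypothesis_of_cofinal_oneSigned fun A ↦ ?_)
  obtain ⟨a, hA, ha⟩ := frequently_atTop.1 (not_eventually.1 hne) A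
  simp only [not_forall, not_not] at ha
  obtain ⟨u, hu, hsign⟩ := ha
  exact ⟨a, hA, u, hu, hsign⟩

end Summit.RiemannHypothesis.RiemannHypothesis.Theorems.PolarPerronFrobenius

end
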